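import Literature.Algebra.EuclideanLattices.FiniteIndexShortDualVector
import Literature.InformationTheory.QuantumCodes.LatticeQuotientSlabs
import Literature.InformationTheory.QuantumCodes.LocalCodeDistanceBoundPeriodic
import Literature.InformationTheory.QuantumCodes.LatticeQuotientLocalityBound
import HarnessLib

/-!
# The Bravyi–Terhal bound on a lattice quotient `ℤ^D/Λ` (Arnault–Gaborit–Rozendaal–Saussay–Zémor 2026, Thm. 3.6)
# — proof

Topic `Literature/InformationTheory/QuantumCodes` (venture QEC, cell `qec`, PARTITION row 06 / LADDER-QEC X1). This
file DISCHARGES the named fact `ArnaultEtAl2026_theorem36` (`LatticeQuotientLocalityBound.lean`, p489824):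
`ArnaultEtAl2026_theorem36_holds`. Ingredients: the short dual functional
(`Literature/Algebra/EuclideanLattices/FiniteIndexShortDualVector.lean`: Hermite's inequality for the dual lattice,
the tree's `hermiteConstant`), the slab combinatorics (`LatticeQuotientSlabs.lean`), and the cyclic slab /
Cleaning-Lemma core of the tree's Bravyi–Terhal proof (`sympDual_le_of_slabs'`,
`LocalCodeDistanceBoundPeriodic.lean`, qec-lit-4). The proof follows [ArnaultEtAl2026, §3.4] with the last
Gram–Schmidt vector replaced by a shortest dual vector and the volume count of Lemma 3.11 replaced by a fibre count
(which gives the constant `1 + 4ρ ≤ √D + 4ρ`). No definitions, no new named facts; `ArnaultEtAl2026_theorem41`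
(abelian 2BGA codes) remains a named fact (it needs, in addition, §4's embedding `G ≅ ℤ^{w−2}/ker Ψ` and the
direct-sum reduction of Lemma 4.3).

References: F. Arnault, P. Gaborit, W. Rozendaal, N. Saussay, G. Zémor, *A Variant of the Bravyi–Terhal Bound for
Arbitrary Boundary Conditions*, IEEE Trans. Inform. Theory 72 (2026) 437–446 = arXiv:2502.04995 [ArnaultEtAl2026]
(Thm. 3.6 chunk p0006 L58–68; §3.4 chunks p0007–p0009); S. Bravyi, B. Terhal, New J. Phys. 11 (2009) 043029
[BravyiTerhal2009] (§2 Lemma 1, Prop. 1 — the Cleaning Lemma, in the tree).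
-/

namespace Literature.InformationTheory.QuantumCodes

open Module Submodule Finset Matrix Literature.Algebra.EuclideanLattices LatticeQuotient
open scoped InnerProductSpace


/-- **Arnault–Gaborit–Rozendaal–Saussay–Zémor 2026, Theorem 3.6 — PROVED** (discharge of the named fact
`ArnaultEtAl2026_theorem36` of `LatticeQuotientLocalityBound.lean`): a stabilizer code whose `N = mn` qubits sit
`m` per vertex on `ℤ^D/Λ` (`|ℤ^D/Λ| = n`, `D ≥ 1`), with a generating family supported in closed Euclidean balls
of radius `ρ > 0`, `k ≥ 1` and `n^{1/D} ≥ 8ρ√γ_D`, has `d < m√γ_D(√D + 4ρ)n^{(D−1)/D}`.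

Proof (the printed strategy of §3.4 with two simplifications). (1) Instead of a lattice basis with a long last
Gram–Schmidt vector (Lemmas 3.8–3.9, Rankin duality) take a shortest vector `y` of the DUAL lattice and
`w = n·y ∈ ℤ^D ∖ 0`: `⟨Λ, w⟩ ⊆ nℤ`, `R := ‖w‖ ≤ √γ_D·n^{(D−1)/D}`
(`exists_short_integer_functional_of_finiteIndex`), so `ℓ := n/R ≥ n^{1/D}/√γ_D ≥ 8ρ`. (2) Slabs are the
preimages of `μ` consecutive arcs of the value circle under `χ : ℤ^D/Λ → ℤ/n`, `x ↦ ⟨x, w⟩ mod n`, with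
`μ = 2⌊n/(4ρR)⌋` even, `μ ≥ 2`, `2ρRμ ≤ n` (a generator of Euclidean diameter `≤ 2ρ` has values in an integer
interval of length `≤ 2ρR ≤ n/μ`, hence meets at most two cyclically adjacent slabs: `abs_sub_dotProduct_le`,
`slab_eq_of_parity_eq` — Lemma 3.12) and `n/μ < 4ρR` (Lemma 3.13). (3) Each slab carries at most `m(⌊n/μ⌋ + g)`
qubits, `g = |ker χ| ≤ |wᵢ| ≤ R` (`card_filter_slab_le` — replacing the volume count of Lemma 3.11, with `1` in
place of `√D`). (4) If `d ≥ m√γ_D(√D + 4ρ)n^{(D−1)/D} > m(n/μ + R) ≥ m(⌊n/μ⌋ + g)` then no slab supports a non-trivial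
logical operator, and the tree's cyclic Cleaning-Lemma core `sympDual_le_of_slabs'` (Bravyi–Terhal;
`LocalCodeDistanceBoundPeriodic.lean`) gives `S̄⊥ ≤ S̄`, contradicting `k ≥ 1` (Lemma 3.10).
[cite: ArnaultEtAl2026, Thm. 3.6 and §3.4 Lemmas 3.7–3.13 (arXiv:2502.04995 chunks p0006 L58–68, p0007–p0009)] -/
theorem ArnaultEtAl2026_theorem36_holds : ArnaultEtAl2026_theorem36 := by
  intro D m n N k d ρ Λ e S hD hρ hidx hloc hcode hk hthr
  classical
  -- (0) `N ≥ 1`, `m ≥ 1`, `n ≠ 0`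
  have hN : 1 ≤ N := by have := hcode.2.1; omega
  have hm : 1 ≤ m := by have := ((e ⟨0, hN⟩).2).isLt; omega
  have hn0 : n ≠ 0 := by
    intro h0
    rw [h0, AddSubgroup.index_eq_zero_iff_infinite] at hidx
    haveI := hidx
    haveI : Nonempty (Fin m) := ⟨⟨0, hm⟩⟩
    exact (not_infinite_iff_finite.2 (Finite.of_equiv (Fin N) e))
      (inferInstance : Infinite (((Fin D → ℤ) ⧸ Λ) × Fin m))
  haveI hfi : Λ.FiniteIndex := ⟨by rw [hidx]; exact hn0⟩
  haveI : NeZero n := ⟨hn0⟩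
  have hnpos : (0 : ℝ) < n := by exact_mod_cast Nat.pos_of_ne_zero hn0
  have hD0 : (D : ℝ) ≠ 0 := by exact_mod_cast (by omega : D ≠ 0)
  -- (1) the short dual functional `w`, its norm `R`, and `R ≤ G := √γ_D n^{(D-1)/D}`
  obtain ⟨w, hw0, hwdiv, hwnorm⟩ := exists_short_integer_functional_of_finiteIndex hD Λ
  rw [hidx] at hwdiv hwnorm
  set R : ℝ := Real.sqrt (∑ i, (w i : ℝ) ^ 2) with hR
  set G : ℝ := Real.sqrt (hermiteConstant D) * (n : ℝ) ^ (((D : ℝ) - 1) / D) with hG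
  have hpow : 0 ≤ (n : ℝ) ^ (((D : ℝ) - 1) / D) := Real.rpow_nonneg hnpos.le _
  have hGnn : 0 ≤ G := mul_nonneg (Real.sqrt_nonneg _) hpow
  have hRG : R ≤ G := by
    rw [hR, hG, ← Real.sqrt_sq hpow, ← Real.sqrt_mul (hermiteConstant_nonneg D)]
    exact Real.sqrt_le_sqrt hwnorm
  obtain ⟨i₁, hi₁⟩ : ∃ i, w i ≠ 0 := Function.ne_iff.1 hw0
  have hwi : (1 : ℝ) ≤ |(w i₁ : ℝ)| := by
    rw [← Int.cast_abs]; exact_mod_cast Int.one_le_abs hi₁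
  have habsR : |(w i₁ : ℝ)| ≤ R := by
    rw [hR]
    refine Real.abs_le_sqrt ?_
    exact Finset.single_le_sum (f := fun i => (w i : ℝ) ^ 2) (fun i _ => sq_nonneg _) (mem_univ i₁)
  have hR1 : 1 ≤ R := hwi.trans habsR
  have hRpos : 0 < R := by linarith
  -- `8 ρ R ≤ n`
  have hn8 : 8 * ρ * R ≤ n := by
    have h1 : 8 * ρ * R ≤ 8 * ρ * G := by nlinarith
    have h3 : (8 * ρ * Real.sqrt (hermiteConstant D)) * (n : ℝ) ^ (((D : ℝ) - 1) / D)
        ≤ (n : ℝ) ^ (1 / (D : ℝ)) * (n : ℝ) ^ (((D : ℝ) - 1) / D) :=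
      mul_le_mul_of_nonneg_right hthr hpow
    have h4 : (n : ℝ) ^ (1 / (D : ℝ)) * (n : ℝ) ^ (((D : ℝ) - 1) / D) = n := by
      rw [← Real.rpow_add hnpos]
      have : 1 / (D : ℝ) + ((D : ℝ) - 1) / D = 1 := by field_simp; ring
      rw [this, Real.rpow_one]
    have h2 : 8 * ρ * G = (8 * ρ * Real.sqrt (hermiteConstant D)) * (n : ℝ) ^ (((D : ℝ) - 1) / D) := by
      rw [hG]; ring
    linarith
  -- (2) the number of slabs `μ` (even, `≥ 2`, `2ρRμ ≤ n`, `n/μ < 4ρR`)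
  have h4ρR : 0 < 4 * ρ * R := by positivity
  have h2ρR : 0 < 2 * ρ * R := by positivity
  set μ : ℕ := 2 * ⌊(n : ℝ) / (4 * ρ * R)⌋₊ with hμ
  have hμe : Even μ := ⟨⌊(n : ℝ) / (4 * ρ * R)⌋₊, by rw [hμ]; ring⟩
  have hfl1 : (1 : ℝ) ≤ (n : ℝ) / (4 * ρ * R) := by rw [le_div_iff₀ h4ρR]; linarith
  have hμ2 : 2 ≤ μ := by
    have : 1 ≤ ⌊(n : ℝ) / (4 * ρ * R)⌋₊ := (Nat.one_le_floor_iff _).2 hfl1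
    omega
  have hμpos : 0 < μ := by omega
  have hμposR : (0 : ℝ) < μ := by exact_mod_cast hμpos
  have hμle : (μ : ℝ) ≤ 2 * ((n : ℝ) / (4 * ρ * R)) := by
    have := Nat.floor_le (show (0 : ℝ) ≤ (n : ℝ) / (4 * ρ * R) by positivity)
    rw [hμ]; push_cast; linarith
  have hμn : 2 * ρ * R * μ ≤ n := by
    have : 2 * ρ * R * (2 * ((n : ℝ) / (4 * ρ * R))) = n := by field_simp; ring
    nlinarith
  have hslab : (n : ℝ) / μ < 4 * ρ * R := by
    have hlt := Nat.lt_floor_add_one ((n : ℝ) / (4 * ρ * R))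
    have hμgt : 2 * ((n : ℝ) / (4 * ρ * R)) - 2 < μ := by rw [hμ]; push_cast; linarith
    rw [div_lt_iff₀ hμposR]
    have : 4 * ρ * R * (2 * ((n : ℝ) / (4 * ρ * R)) - 2) = 2 * n - 8 * ρ * R := by
      field_simp; ring
    nlinarith
  -- (3) the finite quotient `V`, the functional `χ : V → ℤ/n`, slab indices
  haveI : Fintype ((Fin D → ℤ) ⧸ Λ) := Fintype.ofFinite _
  have hcardV : Nat.card ((Fin D → ℤ) ⧸ Λ) = n := hidx
  let φ : (Fin D → ℤ) →+ ZMod n :=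
    { toFun := fun x => ((x ⬝ᵥ w : ℤ) : ZMod n)
      map_zero' := by simp
      map_add' := fun x y => by simp [add_dotProduct] }
  have hφ : Λ ≤ φ.ker := fun g hg => by
    rw [AddMonoidHom.mem_ker]
    exact (ZMod.intCast_zmod_eq_zero_iff_dvd _ _).2 (hwdiv g hg)
  let χ : ((Fin D → ℤ) ⧸ Λ) →+ ZMod n := QuotientAddGroup.lift Λ φ hφ
  have hχ : ∀ x : Fin D → ℤ, χ (QuotientAddGroup.mk x) = ((x ⬝ᵥ w : ℤ) : ZMod n) :=
    fun x => QuotientAddGroup.lift_mk Λ hφ x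
  let sl : ((Fin D → ℤ) ⧸ Λ) → ℕ := fun v => μ * (χ v).val / n
  let β : Fin N → ℕ := fun i => sl (e i).1
  set g : ℕ := Nat.card χ.ker with hg
  have hcount := fun j => card_filter_slab_le χ hcardV hμpos j
  have hgdiv : ∀ v, g ∣ (χ v).val := (hcount 0).1
  have hgn : g ∣ n := (hcount 0).2.1
  -- `g ≤ R`
  have hgR : (g : ℝ) ≤ R := by
    have hgA : g ≤ (w i₁).natAbs := by
      have hApos : 0 < (w i₁).natAbs := Int.natAbs_pos.2 hi₁
      -- some vertex maps to `|w i₁|`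
      obtain ⟨v, hv⟩ : ∃ v, χ v = (((w i₁).natAbs : ℕ) : ZMod n) := by
        rcases Int.natAbs_eq (w i₁) with h | h
        · refine ⟨QuotientAddGroup.mk (Pi.single i₁ 1), ?_⟩
          rw [hχ, single_dotProduct, one_mul, ← Int.cast_natCast, ← h]
        · refine ⟨QuotientAddGroup.mk (-Pi.single i₁ 1), ?_⟩
          have h' : -(w i₁) = ((w i₁).natAbs : ℤ) := by omega
          rw [hχ, neg_dotProduct, single_dotProduct, one_mul, ← Int.cast_natCast, ← h']
      have hdvd : g ∣ (w i₁).natAbs % n := by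
        have := hgdiv v
        rwa [hv, ZMod.val_natCast] at this
      by_cases hmod : (w i₁).natAbs % n = 0
      · have hnA : n ≤ (w i₁).natAbs := Nat.le_of_dvd hApos (Nat.dvd_of_mod_eq_zero hmod)
        exact (Nat.le_of_dvd (Nat.pos_of_ne_zero hn0) hgn).trans hnA
      · exact (Nat.le_of_dvd (Nat.pos_of_ne_zero hmod) hdvd).trans (Nat.mod_le _ _)
    have : ((w i₁).natAbs : ℝ) = |(w i₁ : ℝ)| := by
      rw [Nat.cast_natAbs, Int.cast_abs]
    calc (g : ℝ) ≤ (w i₁).natAbs := by exact_mod_cast hgA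
      _ = |(w i₁ : ℝ)| := this
      _ ≤ R := habsR
  -- (4) generators
  set T : Set (SympVec N) := {v | v ∈ S ∧ IsBallLocal Λ e ρ v} with hT
  have hS : S = Submodule.span (ZMod 2) (Set.range (Subtype.val : T → SympVec N)) := by
    rw [Subtype.range_coe]
    exact le_antisymm hloc (Submodule.span_le.2 fun v hv => hv.1)
  -- (sep) a generator meets at most one slab of each parity
  have hsep : ∀ a : T, ∀ q ∈ sympSupport (a : SympVec N), ∀ q' ∈ sympSupport (a : SympVec N),
      β q % 2 = β q' % 2 → β q = β q' := by
    intro a q hq q' hq' hpar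
    obtain ⟨c, hc⟩ := a.2.2
    obtain ⟨x, hxq, hxc⟩ := hc q hq
    obtain ⟨x', hxq', hxc'⟩ := hc q' hq'
    have hβq : β q = μ * (((x ⬝ᵥ w : ℤ) : ZMod n)).val / n := by
      show μ * (χ (e q).1).val / n = _
      rw [← hxq, hχ]
    have hβq' : β q' = μ * (((x' ⬝ᵥ w : ℤ) : ZMod n)).val / n := by
      show μ * (χ (e q').1).val / n = _
      rw [← hxq', hχ]
    rw [hβq, hβq'] at hpar ⊢
    refine slab_eq_of_parity_eq hμe hμpos ?_ hpar
    have hreal : (μ : ℝ) * |((x ⬝ᵥ w : ℤ) : ℝ) - ((x' ⬝ᵥ w : ℤ) : ℝ)| ≤ n := by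
      calc (μ : ℝ) * |((x ⬝ᵥ w : ℤ) : ℝ) - ((x' ⬝ᵥ w : ℤ) : ℝ)|
          ≤ μ * (2 * ρ * R) := by
            gcongr
            exact abs_sub_dotProduct_le hρ.le hxc hxc'
        _ = 2 * ρ * R * μ := by ring
        _ ≤ n := hμn
    have h' : (((μ : ℤ) * |x ⬝ᵥ w - x' ⬝ᵥ w| : ℤ) : ℝ) ≤ ((n : ℤ) : ℝ) := by
      push_cast; exact hreal
    exact_mod_cast h'
  -- (card) every slab has at most `m (n/μ + g)` qubits
  have hcard : ∀ j, #(slab β j) ≤ m * (n / μ + g) := by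
    intro j
    have hslabj : slab β j = ((univ.filter fun v : (Fin D → ℤ) ⧸ Λ => sl v = j) ×ˢ
        (univ : Finset (Fin m))).map e.symm.toEmbedding := by
      ext i
      simp [slab, β, Finset.mem_map_equiv]
    rw [hslabj, card_map, card_product, card_univ, Fintype.card_fin, mul_comm]
    exact Nat.mul_le_mul_left _ (hcount j).2.2
  -- (5) the bound `B = m (n/μ + g)` is below the printed bound
  set B : ℕ := m * (n / μ + g) with hB
  have hBlt : (B : ℝ) < m * Real.sqrt (hermiteConstant D) * (Real.sqrt D + 4 * ρ) *
      (n : ℝ) ^ (((D : ℝ) - 1) / D) := by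
    have hmpos : (0 : ℝ) < m := by exact_mod_cast hm
    have hdiv : ((n / μ : ℕ) : ℝ) ≤ (n : ℝ) / μ := Nat.cast_div_le
    have hD1 : (1 : ℝ) ≤ Real.sqrt D := by
      rw [show (1 : ℝ) = Real.sqrt 1 by simp]
      exact Real.sqrt_le_sqrt (by exact_mod_cast hD)
    have step1 : (B : ℝ) ≤ m * ((n : ℝ) / μ + R) := by
      rw [hB]; push_cast
      gcongr
    have step2 : (m : ℝ) * ((n : ℝ) / μ + R) < m * (4 * ρ * R + R) := by
      gcongr
    have step3 : (m : ℝ) * (4 * ρ * R + R) ≤ m * ((4 * ρ + Real.sqrt D) * G) := by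
      have : 4 * ρ * R + R = (4 * ρ + 1) * R := by ring
      rw [this]
      exact mul_le_mul_of_nonneg_left
        (mul_le_mul (by linarith) hRG hRpos.le (by positivity)) hmpos.le
    have step4 : (m : ℝ) * ((4 * ρ + Real.sqrt D) * G) = m * Real.sqrt (hermiteConstant D) *
        (Real.sqrt D + 4 * ρ) * (n : ℝ) ^ (((D : ℝ) - 1) / D) := by
      rw [hG]; ring
    linarith
  -- (6) if the printed bound failed, no slab could support a non-trivial logical operator
  by_contra hlt
  push Not at hlt
  have hBd : B < d := by
    have : (B : ℝ) < d := lt_of_lt_of_le hBlt hlt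
    exact_mod_cast this
  have h0 : ∀ j, ∀ Q ∈ sympDual S, Q ∈ supportedOn (slab β j) → Q ∈ S := by
    intro j Q hQd hQs
    by_contra hQS
    have h1 := hcode.2.2.1 Q hQd hQS
    have h2 := sympWeight_le_card_of_mem hQs
    have h3 := hcard j
    omega
  have hle := Submodule.finrank_mono (sympDual_le_of_slabs' β _ hS hcode.1 hsep h0)
  rw [hcode.finrank_sympDual] at hle
  have hdim := hcode.2.1
  omega

end Literature.InformationTheory.QuantumCodes
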